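import Summits.BirchSwinnertonDyer.BirchSwinnertonDyer.Theorems.ClassRecordThreeCornerAtThreeRingClassGalSplitCyclic
import Literature.NumberTheory.NumberFields.RingClassFieldOfConductor
import HarnessLib

/-!
# `p^E ∣ orderOf [𝔮]_ℓ` in `Pic(𝒪_ℓ) = I_K(ℓ)/P_{K,ℤ}(ℓ)` from «`β^{(ℓ−1)/p}` is NOT congruent to a rational integer mod `ℓ𝒪_K`», `(β) = 𝔮^n`,
# `ℓ ≡ 1 (mod p^E)` a SPLIT prime — dictionary (D3) of the split prime-conductor Chebotarev–Kummer supply (c′)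
# (cell `bsd-stepL`, seat `bsd-stepL-corner3-p2` g14 = lane B, LINE OWNER of crux 21420 `CornerAtThreeW`; `--supports stmt-BirchSwinnertonDyer-21420 --as helper`)

WHY. The r18/r19 residual stub of `Cruxes/CornerAtThreeW/Lines/inert.lean` carries (c′), whose last clause is `3 ^ E ∣ orderOf (primeClass ℓ₀ v)` for the primes
`v ∣ q` of `K` at an auxiliary split prime `ℓ₀` (lane B g14 memo CORNER3-G14 §6–§7). A Chebotarev–Kummer argument delivers `ℓ₀ ≡ 1 (mod 3^E)` and a Frobenius acting
non-trivially on a cube root, i.e. (after conjugation) «`β^{(ℓ₀−1)/3} ≢ a (mod ℓ₀𝒪_K)` for every `a ∈ ℤ`», where `𝔮^n = (β)`. THIS FILE turns that into the ORDER statement,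
inside Cox's `Pic(𝒪_ℓ) = I_K(ℓ)/P_{K,ℤ}(ℓ)` (tree: `RingClassGroup K ℓ`, `primeClass`, Cox's `θ_ℓ : (𝒪_K/ℓ)ˣ → Pic(𝒪_ℓ)` = `RingClass.theta`):
* `idealClass_pow_eq_primeClass_pow` — `[𝔮^n]_ℓ = [𝔮]_ℓ^n`;
* `theta_mk_eq_primeClass_pow` — `θ_ℓ(β mod ℓ) = [𝔮]_ℓ^n` when `𝔮^n = (β)` (`idealClass_span_eq` + `theta_eq`);
* `theta_pow_ne_one_of_not_rational` — for `d_K < −4` (`𝒪_Kˣ = {±1}`): `θ_ℓ(x)^k ≠ 1` as soon as `x^k ≢ a (mod ℓ)` for all `a ∈ ℤ` (`theta_eq_one_iff`);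
* `orderOf_theta_dvd_pred_of_split` — for an odd SPLIT prime `ℓ`: `orderOf θ_ℓ(x) ∣ ℓ − 1` (`range θ_ℓ = ker(Pic(𝒪_ℓ) → Cl_K)` has order `ℓ − (d_K/ℓ) = ℓ − 1`:
  hodge lane `CMTypeLattice.nonempty_mulEquiv_ker_toClassGroup_unitsQuot_of_discr_lt` + `natCard_unitsQuot_zmod_eq` + `Quadratic.ncard_primesOver_eq_two_iff_jacobiSym`);
* `pow_dvd_orderOf_primeClass_of_not_rational` — **(D3)**: `p^E ∣ ℓ − 1`, `𝔮 ∤ ℓ`, `𝔮^n = (β)`, `∀ a : ℤ, β^{(ℓ−1)/p} − a ∉ ℓ𝒪_K` ⟹ `p^E ∣ orderOf (primeClass ℓ 𝔮)`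
  (arithmetic: `d := orderOf θ(β) ∣ ℓ − 1`, `d ∤ (ℓ−1)/p` ⟹ `p^E ∣ d ∣ orderOf [𝔮]_ℓ`).
HONEST FRAMING: THEOREMS ONLY (no definition, no named fact, no `sorry`); pure class field theory of orders in an imaginary quadratic field; nothing about any curve;
no stub ∕ item closes; 21420 OPEN; no census label moves (T7); BSD is proved for no curve.
References (locators only): [cite: Cox2013, §7.A, §7.C Prop. 7.20–7.22, §7.D Thm. 7.24 and (7.27)] [cite: GrossLMS1991, §1 (𝒪ˣ = ±1), §3].
presearch: in-tree (hodge lane `CMLatticeRingClassTowerKernelUnitsQuotient`, `RingClassNumber`, `RingClassFieldOfConductor`). Axioms: `propext`, `Classical.choice`, `Quot.sound`.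
-/

set_option autoImplicit false
set_option linter.dupNamespace false

noncomputable section

open scoped Classical NumberField

namespace Summit.BirchSwinnertonDyer.BirchSwinnertonDyer.Theorems.RingClassSplit

open Module NumberField IsDedekindDomain
open Literature.NumberTheory.EllipticCurves
open Literature.NumberTheory.NumberFields Literature.NumberTheory.NumberFields.RingClassField
open Literature.NumberTheory.QuadraticFields Literature.NumberTheory.QuadraticFields.RingClass
open Literature.NumberTheory.QuadraticFields.Quadratic
open Literature.NumberTheory.ComplexMultiplication

variable {K : Type} [Field K] [NumberField K]

/-! ## §1 `[𝔮^n]_ℓ = [𝔮]_ℓ^n` and `θ_ℓ(β) = [𝔮]_ℓ^n` for `𝔮^n = (β)` -/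

/-- **`[𝔮^n]_f = [𝔮]_f^n`** in `I_K(f)/P_{K,ℤ}(f)` for a prime `𝔮 ∤ f` (`idealClass_mul`, induction on `n`). [cite: Cox2013, §7.C Prop. 7.22] -/
theorem idealClass_pow_eq_primeClass_pow (f : ℕ) (v : HeightOneSpectrum (𝓞 K)) (hv : v.asIdeal ⊔ Ideal.span {(f : 𝓞 K)} = ⊤)
    (n : ℕ) :
    idealClass f (pow_ne_zero n v.ne_bot : v.asIdeal ^ n ≠ ⊥) (Ideal.pow_sup_eq_top hv) = primeClass f v ^ n := by
  -- proof-irrelevant congruence for `idealClass`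
  have congr_ : ∀ (I J : Ideal (𝓞 K)) (hI : I ≠ ⊥) (hcI : I ⊔ Ideal.span {(f : 𝓞 K)} = ⊤) (hJ : J ≠ ⊥)
      (hcJ : J ⊔ Ideal.span {(f : 𝓞 K)} = ⊤), I = J → idealClass f hI hcI = idealClass f hJ hcJ := by
    rintro I J hI hcI hJ hcJ rfl
    rfl
  induction n with
  | zero =>
    have htop : (⊤ : Ideal (𝓞 K)) ⊔ Ideal.span {(f : 𝓞 K)} = ⊤ := top_sup_eq _
    rw [congr_ (v.asIdeal ^ 0) ⊤ _ _ top_ne_bot htop (by rw [pow_zero, Ideal.one_eq_top]), idealClass_top, pow_zero]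
  | succ n ih =>
    have hmul : v.asIdeal ^ n * v.asIdeal ⊔ Ideal.span {(f : 𝓞 K)} = ⊤ := by
      rw [← pow_succ]; exact Ideal.pow_sup_eq_top hv
    rw [congr_ (v.asIdeal ^ (n + 1)) (v.asIdeal ^ n * v.asIdeal) _ _ (mul_ne_zero (pow_ne_zero n v.ne_bot) v.ne_bot) hmul
        (pow_succ _ _), idealClass_mul (f := f) (pow_ne_zero n v.ne_bot) v.ne_bot (Ideal.pow_sup_eq_top hv) hv hmul, ih,
      ← primeClass_of_sup_eq_top (f := f) hv, pow_succ]

/-- **`θ_f(β mod f) = [𝔮]_f^n` when `𝔮^n = (β)`**, `𝔮 ∤ f`: Cox's `θ_f([α]) = [α𝒪_K]` (`theta_eq`) and `[(β)] = [𝔮^n] = [𝔮]^n`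
(`idealClass_span_eq`, §1). Here `x` is any unit of `𝒪_K/f` represented by `β`. [cite: Cox2013, §7.C Prop. 7.22, §7.D (7.27)] -/
theorem theta_eq_primeClass_pow (b : Basis (Fin 2) ℤ (𝓞 K)) (hb : b 0 = 1) {t m : ℤ}
    (hω : b 1 * b 1 = (m : 𝓞 K) + (t : 𝓞 K) * b 1) {f : ℕ} (hf : Ideal.span {(f : 𝓞 K)} ≠ ⊤)
    (v : HeightOneSpectrum (𝓞 K)) (hv : v.asIdeal ⊔ Ideal.span {(f : 𝓞 K)} = ⊤) {n : ℕ} {β : 𝓞 K}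
    (hβ : v.asIdeal ^ n = Ideal.span {β}) (x : (𝓞 K ⧸ Ideal.span {(f : 𝓞 K)})ˣ)
    (hx : Ideal.Quotient.mk (Ideal.span {(f : 𝓞 K)}) β = x) :
    theta K f b hb hω hf x = primeClass f v ^ n := by
  have hβ0 : β ≠ 0 := by
    intro h
    apply pow_ne_zero n v.ne_bot
    rw [hβ, Submodule.zero_eq_bot, Ideal.span_singleton_eq_bot]
    exact h
  have hcop : Ideal.span {β} ⊔ Ideal.span {(f : 𝓞 K)} = ⊤ := by rw [← hβ]; exact Ideal.pow_sup_eq_top hv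
  rw [← idealClass_pow_eq_primeClass_pow f v hv n, theta_eq b hb hω hf hx]
  have key : ∀ (I : Ideal (𝓞 K)) (hI : I ≠ ⊥) (hc : I ⊔ Ideal.span {(f : 𝓞 K)} = ⊤), I = Ideal.span {β} →
      idealClass f hI hc = idealClass f (by simpa [Ideal.span_singleton_eq_bot] using hβ0 : Ideal.span {β} ≠ ⊥) hcop := by
    rintro I hI hc rfl
    rfl
  rw [key _ _ _ hβ, idealClass_span_eq]

/-! ## §2 `θ_ℓ(x)^k ≠ 1` from «`x^k` is not rational mod `ℓ`» (`𝒪_Kˣ = {±1}`) -/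

/-- **`θ_f(x)^k ≠ 1` as soon as `x^k ≢ a (mod f𝒪_K)` for every `a ∈ ℤ`**, for `K` imaginary quadratic with `d_K < −4` (so `𝒪_Kˣ = {±1}` and
`ker θ_f = (ℤ/f)ˣ·𝒪_Kˣ = (ℤ/f)ˣ`: `theta_eq_one_iff`, `CMTypeLattice.units_eq_one_or_eq_neg_one_of_discr_lt`). [cite: Cox2013, §7.D (7.27), Exercise 7.30]
[cite: GrossLMS1991, §1] -/
theorem theta_pow_ne_one_of_not_rational (hK : IsImaginaryQuadratic K) (hD : NumberField.discr K < -4)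
    (b : Basis (Fin 2) ℤ (𝓞 K)) (hb : b 0 = 1) {t m : ℤ} (hω : b 1 * b 1 = (m : 𝓞 K) + (t : 𝓞 K) * b 1) {f : ℕ}
    (hf : Ideal.span {(f : 𝓞 K)} ≠ ⊤) (x : (𝓞 K ⧸ Ideal.span {(f : 𝓞 K)})ˣ) (k : ℕ)
    (hx : ∀ a : ℤ, ((x ^ k : (𝓞 K ⧸ Ideal.span {(f : 𝓞 K)})ˣ) : 𝓞 K ⧸ Ideal.span {(f : 𝓞 K)}) ≠
      Ideal.Quotient.mk (Ideal.span {(f : 𝓞 K)}) (a : 𝓞 K)) :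
    theta K f b hb hω hf x ^ k ≠ 1 := by
  haveI : IsCMField K := hK.isCMField
  intro h
  rw [← map_pow, theta_eq_one_iff b hb hω hf] at h
  obtain ⟨ε, a, -, hεa⟩ := h
  rcases CMTypeLattice.units_eq_one_or_eq_neg_one_of_discr_lt hK.1 hD ε with rfl | rfl
  · exact hx a (by rw [hεa, Units.val_one, one_mul])
  · exact hx (-a) (by rw [hεa, Units.val_neg, Units.val_one, neg_one_mul, Int.cast_neg, map_neg])

/-! ## §3 `orderOf θ_ℓ(x) ∣ ℓ − 1` at a SPLIT prime `ℓ` -/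

/-- **`orderOf θ_ℓ(x) ∣ ℓ − 1` for an odd prime `ℓ` SPLIT in the imaginary quadratic `K`, `d_K < −4`**: `θ_ℓ(x) ∈ range θ_ℓ = ker(Pic(𝒪_ℓ) → Cl_K)`
(`range_theta_eq_ker`), a group of order `#((𝒪_K/ℓ)ˣ/(ℤ/ℓ)ˣ) = ℓ − (d_K/ℓ) = ℓ − 1` (hodge lane `nonempty_mulEquiv_ker_toClassGroup_unitsQuot_of_discr_lt`,
`natCard_unitsQuot_zmod_eq`; `(d_K/ℓ) = 1` by `Quadratic.ncard_primesOver_eq_two_iff_jacobiSym`). [cite: Cox2013, §7.D Thm. 7.24 and (7.27)] -/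
theorem orderOf_theta_dvd_pred_of_split (hK : IsImaginaryQuadratic K) (hD : NumberField.discr K < -4)
    (b : Basis (Fin 2) ℤ (𝓞 K)) (hb : b 0 = 1) {t m : ℤ} (hω : b 1 * b 1 = (m : 𝓞 K) + (t : 𝓞 K) * b 1) {ℓ : ℕ}
    (hℓ : ℓ.Prime) (hℓ2 : ℓ ≠ 2) (hsplit : ((Ideal.span {(ℓ : ℤ)}).primesOver (𝓞 K)).ncard = 2)
    (hf : Ideal.span {(ℓ : 𝓞 K)} ≠ ⊤) (x : (𝓞 K ⧸ Ideal.span {(ℓ : 𝓞 K)})ˣ) :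
    orderOf (theta K ℓ b hb hω hf x) ∣ ℓ - 1 := by
  have h2 : finrank ℚ K = 2 := hK.1
  haveI : IsCMField K := hK.isCMField
  haveI : CharP (𝓞 K ⧸ Ideal.span {(ℓ : 𝓞 K)}) ℓ := charP_quot b hb
  have hmem : theta K ℓ b hb hω hf x ∈ (toClassGroup K ℓ).ker := by
    rw [← range_theta_eq_ker b hb hω hf]; exact ⟨x, rfl⟩
  obtain ⟨e⟩ := CMTypeLattice.nonempty_mulEquiv_ker_toClassGroup_unitsQuot_of_discr_lt h2 hD (f := ℓ) hℓ.two_le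
  have hcardZ := CMTypeLattice.natCard_unitsQuot_zmod_eq (K := K) h2 hℓ
  have hjac : jacobiSym (NumberField.discr K) ℓ = 1 := (ncard_primesOver_eq_two_iff_jacobiSym h2 hℓ hℓ2).mp hsplit
  rw [if_neg hℓ2, hjac, ← Nat.card_congr e.toEquiv] at hcardZ
  have hcard : Nat.card (toClassGroup K ℓ).ker = ℓ - 1 := by
    zify [hℓ.one_lt.le]
    exact hcardZ
  exact hcard ▸ Subgroup.orderOf_dvd_natCard _ hmem

/-! ## §4 (D3): `p^E ∣ orderOf [𝔮]_ℓ` -/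

/-- **(D3) `p^E ∣ orderOf [𝔮]_ℓ` in `Pic(𝒪_ℓ)`.** `K` imaginary quadratic with `d_K < −4`; `ℓ` an odd prime SPLIT in `K`; `p` a prime with `p^E ∣ ℓ − 1`, `E ≥ 1`;
`𝔮 ∤ ℓ` a prime of `K` with `𝔮^n = (β)`; and «`β^{(ℓ−1)/p} ≢ a (mod ℓ𝒪_K)` for every `a ∈ ℤ`» (the Kummer condition a Chebotarev Frobenius delivers). THEN
`p^E ∣ orderOf (primeClass ℓ 𝔮)`: with `d := orderOf θ_ℓ(β)`, §3 gives `d ∣ ℓ − 1`, §2 gives `d ∤ (ℓ − 1)/p`, hence `p^E ∣ d`; and `θ_ℓ(β) = [𝔮]_ℓ^n` (§1) so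
`d ∣ orderOf [𝔮]_ℓ`. [cite: Cox2013, §7.D Thm. 7.24 and (7.27)] [cite: GrossLMS1991, §1, §3] -/
theorem pow_dvd_orderOf_primeClass_of_not_rational (hK : IsImaginaryQuadratic K) (hD : NumberField.discr K < -4)
    {ℓ : ℕ} (hℓ : ℓ.Prime) (hℓ2 : ℓ ≠ 2) (hsplit : ((Ideal.span {(ℓ : ℤ)}).primesOver (𝓞 K)).ncard = 2)
    {p E : ℕ} (hp : p.Prime) (hE1 : 1 ≤ E) (hE : p ^ E ∣ ℓ - 1)
    (v : HeightOneSpectrum (𝓞 K)) (hv : v.asIdeal ⊔ Ideal.span {(ℓ : 𝓞 K)} = ⊤) {n : ℕ} {β : 𝓞 K}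
    (hβ : v.asIdeal ^ n = Ideal.span {β})
    (hx : ∀ a : ℤ, β ^ ((ℓ - 1) / p) - (a : 𝓞 K) ∉ Ideal.span {(ℓ : 𝓞 K)}) :
    p ^ E ∣ orderOf (primeClass ℓ v) := by
  have h2 : finrank ℚ K = 2 := hK.1
  obtain ⟨b, hb⟩ := exists_basis_zero_eq_one h2
  have hω := basis_one_mul_self_eq b hb
  -- `ℓ𝒪_K ≠ ⊤`
  have hf : Ideal.span {(ℓ : 𝓞 K)} ≠ ⊤ := span_natCast_ne_top_of_ne_one b hb hℓ.ne_one
  -- the unit `x = β mod ℓ`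
  have hβ0 : β ≠ 0 := by
    intro h
    apply pow_ne_zero n v.ne_bot
    rw [hβ, Submodule.zero_eq_bot, Ideal.span_singleton_eq_bot]
    exact h
  have hcop : Ideal.span {β} ⊔ Ideal.span {(ℓ : 𝓞 K)} = ⊤ := by rw [← hβ]; exact Ideal.pow_sup_eq_top hv
  have hu : IsUnit (Ideal.Quotient.mk (Ideal.span {(ℓ : 𝓞 K)}) β) := isUnit_mk_of_sup_eq_top hcop
  set x := hu.unit with hxdef
  have hxβ : Ideal.Quotient.mk (Ideal.span {(ℓ : 𝓞 K)}) β = x := by rw [hxdef, IsUnit.unit_spec]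
  have hθ : theta K ℓ b hb hω hf x = primeClass ℓ v ^ n := theta_eq_primeClass_pow b hb hω hf v hv hβ x hxβ
  -- `d := orderOf θ(x)` divides `ℓ − 1` and does not divide `(ℓ − 1)/p`
  set d := orderOf (theta K ℓ b hb hω hf x) with hd
  have hd1 : d ∣ ℓ - 1 := orderOf_theta_dvd_pred_of_split hK hD b hb hω hℓ hℓ2 hsplit hf x
  have hne : theta K ℓ b hb hω hf x ^ ((ℓ - 1) / p) ≠ 1 := by
    refine theta_pow_ne_one_of_not_rational hK hD b hb hω hf x _ fun a ha ↦ hx a ?_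
    rw [← Ideal.Quotient.eq, map_pow, hxβ, ← ha, Units.val_pow_eq_pow_val]
  have hd2 : ¬ d ∣ (ℓ - 1) / p := fun h ↦ hne (orderOf_dvd_iff_pow_eq_one.mp h)
  -- arithmetic: `p ∣ ℓ − 1`, `d ∣ ℓ − 1`, `d ∤ (ℓ−1)/p` ⟹ `p^E ∣ d`
  have hpl : p ∣ ℓ - 1 := (dvd_pow_self p (by omega : E ≠ 0)).trans hE
  obtain ⟨c, hc⟩ := hd1
  have hpc : ¬ p ∣ c := by
    rintro ⟨c', rfl⟩
    apply hd2
    refine ⟨c', ?_⟩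
    rw [hc, ← mul_assoc, mul_comm d p, mul_assoc, Nat.mul_div_cancel_left _ hp.pos]
  have hcopr : Nat.Coprime (p ^ E) c := (Nat.Coprime.pow_left E ((Nat.Prime.coprime_iff_not_dvd hp).mpr hpc))
  have hEd : p ^ E ∣ d := by
    have : p ^ E ∣ d * c := hc ▸ hE
    exact hcopr.dvd_of_dvd_mul_right this
  -- `d ∣ orderOf [𝔮]_ℓ`
  have hd3 : d ∣ orderOf (primeClass ℓ v) := by rw [hd, hθ]; exact orderOf_pow_dvd n
  exact hEd.trans hd3

end Summit.BirchSwinnertonDyer.BirchSwinnertonDyer.Theorems.RingClassSplit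

end
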